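import Literature.Analysis.FluidPDE.StokesTorusConvectionMode
import Literature.Analysis.FluidPDE.StokesTorusDomainProofs
import Literature.Analysis.FunctionSpaces.TorusLatticeProductLaw
import HarnessLib

/-!
# Coefficients of the mild Navier–Stokes bilinear form on `T³`: weight, square-summability, bookkeeping

Analysis/FluidPDE support file (everything proved; no definitions, no named facts), first half of
the construction of the bounded bilinear form `N(y, z) = A^{-3/4} (1 + A)^{1/2} P B(S y, S z)` of the
mild formulation of the Navier–Stokes equations on the energy space `H = Torus.energySpace d` of a
three-dimensional flat torus (`StokesTorusBilinearForm.lean`).  With `u = S y`, `w = S z` and the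
weight `γₖ = λₖ^{-3/4} (1 + λₖ)^{1/2}`, `λₖ = 4π²|k|²`, the coefficient family of `N(y, z)` against the
Fourier modes is `G(k) = -γₖ · (-2πi) · 𝓕(⟪k, u⟫ w)(k)`; this file proves

* `Torus.stokesWeight_bound` — `(2π)² γₖ² d |k|² ≤ 4πd ⟨k⟩` (`A^{-3/4}(1+A)^{1/2} ∇ ≈ A^{-1/4}`);
* `Torus.isConjSymm_stokesWeight_smul_mFourierCoeff` — `G` is conjugate symmetric (reality);
* `Torus.tsum_enorm_sq_stokesWeight_smul_mFourierCoeff_le` — the QUANTITATIVE SQUARE-SUMMABILITY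
  `∑ₖ ‖G(k)‖² ≤ C (∑ⱼ ⟨j⟩² ‖ŵ(j)‖²)(∑ⱼ ⟨j⟩² ‖û(j)‖²)` on `ℤ³`, from the product bound
  `Torus.enorm_sq_mFourierCoeff_inner_smul_le` and the lattice product law `H¹ · H¹ ⊂ H^{1/2}`
  (`Lattice.tsum_weight_mul_conv_sq_le`) — the Fourier form of the Fujita–Kato / Constantin–Foias
  estimate `‖A^{-1/4} P B(u, w)‖ ≤ C ‖u‖_{H¹} ‖w‖_{H¹}` (Constantin–Foias 1988, Ch. 6, (6.9)–(6.10)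
  with `s₁ = s₂ = 1`, `s₃ = 1/2`; Fujita–Kato 1964, Lemma 1.3);
* `L²` bookkeeping (`Torus.mFourierCoeff_complexify_coe_add`, `Torus.Lp_eq_of_forall_mFourierCoeff_eq`,
  `Torus.summable_sq_norm_of_tsum_enorm_sq_ne_top`) and `Torus.eq_stokesEigenvalue_of_coe_eq_stokesModeL2`
  (a unit vector that is a Stokes mode of frequency `k` has the eigenvalue `4π²|k|²`, by
  functionality of the Stokes graph).

## References

* P. Constantin, C. Foias, *Navier–Stokes Equations*, Univ. Chicago Press (1988), Ch. 6,
  (6.9)–(6.10), (6.19). [ConstantinFoiasNSE1988]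
* H. Fujita, T. Kato, On the Navier–Stokes initial value problem. I, Arch. Rational Mech. Anal. 16
  (1964) 269–315, Lemma 1.3–1.4. [FujitaKato1964ARMA]
-/

noncomputable section

open MeasureTheory Filter UnitAddTorus
open scoped InnerProductSpace RealInnerProductSpace ENNReal Topology ComplexConjugate

namespace Literature.Analysis.FluidPDE

namespace Torus

variable {d : Type*} [Fintype d] [DecidableEq d]

/-! ### The weight `γₖ = λₖ^{-3/4} (1 + λₖ)^{1/2}` -/

omit [DecidableEq d] in
/-- **The weight bound**: `(2π)² γₖ² d |k|² ≤ 4πd (1 + |k|²)^{1/2}` for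
`γₖ = λₖ^{-3/4}(1 + λₖ)^{1/2}`, `λₖ = 4π²|k|²` (with `q = λₖ^{1/4}`: the left side is
`d (1 + q⁴)/q² ≤ 2 d q² = 4π d |k| `). This is where `A^{-3/4}(1+A)^{1/2} ∇ ≈ A^{-1/4}` appears.
[folklore] -/
theorem stokesWeight_bound (k : d → ℤ) :
    (2 * Real.pi) ^ 2 * (stokesEigenvalue k ^ (-(3 / 4 : ℝ)) * (1 + stokesEigenvalue k) ^ (1 / 2 : ℝ)) ^ 2 *
        (Fintype.card d) * FunctionSpaces.Torus.freqNormSq k ≤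
      4 * Real.pi * Fintype.card d * (1 + FunctionSpaces.Torus.freqNormSq k) ^ (1 / 2 : ℝ) := by
  have hπ := Real.pi_pos
  by_cases hk : k = 0
  · subst hk
    rw [FunctionSpaces.Torus.freqNormSq_zero, mul_zero]
    positivity
  · set n : ℝ := FunctionSpaces.Torus.freqNormSq k with hn_def
    have hn : 1 ≤ n := FunctionSpaces.Torus.one_le_freqNormSq_of_ne_zero hk
    set l : ℝ := stokesEigenvalue k with hl_def
    have hl : l = 4 * Real.pi ^ 2 * n := rfl
    have hl1 : 1 ≤ l := by rw [hl]; nlinarith [Real.two_le_pi]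
    have hl0 : 0 < l := by linarith
    set q : ℝ := l ^ (1 / 4 : ℝ) with hq_def
    have hq0 : 0 < q := Real.rpow_pos_of_pos hl0 _
    have hq4 : q ^ 4 = l := by
      rw [hq_def, ← Real.rpow_natCast, ← Real.rpow_mul hl0.le]; norm_num
    have hq2 : q ^ 2 = Real.sqrt l := by
      rw [hq_def, ← Real.rpow_natCast, ← Real.rpow_mul hl0.le, Real.sqrt_eq_rpow]; norm_num
    have h34 : l ^ (-(3 / 4 : ℝ)) = (q ^ 3)⁻¹ := by
      rw [Real.rpow_neg hl0.le, hq_def, ← Real.rpow_natCast (l ^ (1 / 4 : ℝ)),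
        ← Real.rpow_mul hl0.le]
      norm_num
    have h12 : (1 + l) ^ (1 / 2 : ℝ) = Real.sqrt (1 + l) := by rw [Real.sqrt_eq_rpow]
    have hsq : ((q ^ 3)⁻¹ * Real.sqrt (1 + l)) ^ 2 = (1 + l) / q ^ 6 := by
      rw [mul_pow, Real.sq_sqrt (by linarith), inv_pow, ← pow_mul]
      field_simp
    have h2πn : (2 * Real.pi) ^ 2 * n = q ^ 4 := by rw [hq4, hl]; ring
    have hsqrt : Real.sqrt l = 2 * Real.pi * Real.sqrt n := by
      rw [hl, show 4 * Real.pi ^ 2 * n = (2 * Real.pi) ^ 2 * n by ring,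
        Real.sqrt_mul (by positivity), Real.sqrt_sq (by positivity)]
    have h1l : 1 + l ≤ 2 * q ^ 4 := by rw [hq4]; linarith
    rw [h34, h12, hsq]
    calc (2 * Real.pi) ^ 2 * ((1 + l) / q ^ 6) * (Fintype.card d) * n
        = ((2 * Real.pi) ^ 2 * n) * (1 + l) * (Fintype.card d) / q ^ 6 := by ring
      _ = (1 + l) * (Fintype.card d) / q ^ 2 := by
          rw [h2πn]
          field_simp
      _ ≤ 2 * q ^ 4 * (Fintype.card d) / q ^ 2 := by gcongr
      _ = 2 * (Fintype.card d) * (2 * Real.pi * Real.sqrt n) := by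
          rw [← hsqrt, ← hq2]
          field_simp
      _ ≤ 2 * (Fintype.card d) * (2 * Real.pi * Real.sqrt (1 + n)) := by
          gcongr
          linarith
      _ = 4 * Real.pi * Fintype.card d * (1 + n) ^ (1 / 2 : ℝ) := by
          rw [Real.sqrt_eq_rpow]
          ring

/-- `‖k‖² = |k|²` for the lattice vector of a frequency (a `private` copy of the same statement in
`DeRosaTimeRegularityProofs`, to keep the imports light). [folklore] -/
private theorem norm_latticeVec_sq_aux (k : d → ℤ) :
    ‖FunctionSpaces.Torus.latticeVec k‖ ^ 2 = FunctionSpaces.Torus.freqNormSq k := by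
  rw [EuclideanSpace.norm_sq_eq]
  refine Finset.sum_congr rfl fun i _ => ?_
  rw [FunctionSpaces.Torus.latticeVec_apply, Real.norm_eq_abs, sq_abs]

/-! ### The coefficient family `G(k) = -γₖ (-2πi) 𝓕(⟪k, u⟫ w)(k)` -/

/-- **Conjugate symmetry of the coefficient family** `k ↦ -γₖ · (-2πi) · 𝓕(⟪k, u⟫ w)(k)` of two
`L²` real fields (`γ₋ₖ = γₖ` real, `𝓕(⟪-k, u⟫ w)(-k) = -conj 𝓕(⟪k, u⟫ w)(k)`,
`Torus.mFourierCoeff_inner_smul_neg`). [folklore] -/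
theorem isConjSymm_stokesWeight_smul_mFourierCoeff {u w : UnitAddTorus d → EuclideanSpace ℝ d}
    (hu : MemLp u 2 volume) (hw : MemLp w 2 volume) :
    FunctionSpaces.Torus.IsConjSymm fun k : d → ℤ =>
      ((-(stokesEigenvalue k ^ (-(3 / 4 : ℝ)) * (1 + stokesEigenvalue k) ^ (1 / 2 : ℝ)) : ℝ) : ℂ) •
        ((-(2 * Real.pi * Complex.I)) •
          mFourierCoeff (FunctionSpaces.EuclideanSpace.complexify ∘
            fun x => ⟪FunctionSpaces.Torus.latticeVec k, u x⟫_ℝ • w x) k) := by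
  intro k
  dsimp only
  rw [mFourierCoeff_inner_smul_neg hu hw k, stokesEigenvalue_neg,
    FunctionSpaces.EuclideanSpace.conjVec_smul, FunctionSpaces.EuclideanSpace.conjVec_smul,
    Complex.conj_ofReal, smul_neg, ← neg_smul]
  congr 2
  simp [Complex.conj_ofReal, map_ofNat]

/-- **Square-summability of the coefficient family, quantitatively** (the heart of the
boundedness of `N`): on a three-dimensional torus there is `C ≥ 0` with
`∑ₖ ‖γₖ (2πi) 𝓕(⟪k, u⟫ w)(k)‖² ≤ C (∑ⱼ ⟨j⟩² ‖ŵ(j)‖²) (∑ⱼ ⟨j⟩² ‖û(j)‖²)` for all `L²` fields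
`u, w` — termwise `‖·‖² ≤ 4πd ⟨k⟩ (∑ⱼ ‖ŵ(k-j)‖ ‖û(j)‖)²` (`Torus.enorm_sq_mFourierCoeff_inner_smul_le`,
`Torus.stokesWeight_bound`), then the lattice product law `Lattice.tsum_weight_mul_conv_sq_le`
(Constantin–Foias 1988, Ch. 6, (6.9)–(6.10), `s₁ = s₂ = 1`, `s₃ = 1/2`; Fujita–Kato 1964,
Lemma 1.3). [cite: ConstantinFoiasNSE1988, Ch. 6 (6.9)–(6.10)] -/
theorem tsum_enorm_sq_stokesWeight_smul_mFourierCoeff_le (hd : Fintype.card d = 3) :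
    ∃ C : ℝ, 0 ≤ C ∧ ∀ (u w : UnitAddTorus d → EuclideanSpace ℝ d), MemLp u 2 volume → MemLp w 2 volume →
      ∑' k : d → ℤ, ‖((-(stokesEigenvalue k ^ (-(3 / 4 : ℝ)) * (1 + stokesEigenvalue k) ^ (1 / 2 : ℝ)) : ℝ) : ℂ) •
          ((-(2 * Real.pi * Complex.I)) •
            mFourierCoeff (FunctionSpaces.EuclideanSpace.complexify ∘
              fun x => ⟪FunctionSpaces.Torus.latticeVec k, u x⟫_ℝ • w x) k)‖ₑ ^ 2 ≤
        ENNReal.ofReal C *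
          ((∑' j : d → ℤ, ENNReal.ofReal (1 + FunctionSpaces.Torus.freqNormSq j) *
              ‖mFourierCoeff (FunctionSpaces.EuclideanSpace.complexify ∘ w) j‖ₑ ^ 2) *
            (∑' j : d → ℤ, ENNReal.ofReal (1 + FunctionSpaces.Torus.freqNormSq j) *
              ‖mFourierCoeff (FunctionSpaces.EuclideanSpace.complexify ∘ u) j‖ₑ ^ 2)) := by
  obtain ⟨K, hK, hPL⟩ := FunctionSpaces.Lattice.tsum_weight_mul_conv_sq_le (d := d) hd
  have hπ := Real.pi_pos
  refine ⟨4 * Real.pi * Fintype.card d * K, by positivity, fun u w hu hw => ?_⟩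
  set U : (d → ℤ) → ℝ≥0∞ := fun j => ‖mFourierCoeff (FunctionSpaces.EuclideanSpace.complexify ∘ w) j‖ₑ
    with hU
  set W : (d → ℤ) → ℝ≥0∞ := fun j => ‖mFourierCoeff (FunctionSpaces.EuclideanSpace.complexify ∘ u) j‖ₑ
    with hW
  set γ : (d → ℤ) → ℝ := fun k =>
    stokesEigenvalue k ^ (-(3 / 4 : ℝ)) * (1 + stokesEigenvalue k) ^ (1 / 2 : ℝ) with hγ
  -- termwise bound
  have hterm : ∀ k : d → ℤ,
      ‖((-γ k : ℝ) : ℂ) • ((-(2 * Real.pi * Complex.I)) •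
          mFourierCoeff (FunctionSpaces.EuclideanSpace.complexify ∘
            fun x => ⟪FunctionSpaces.Torus.latticeVec k, u x⟫_ℝ • w x) k)‖ₑ ^ 2 ≤
        ENNReal.ofReal (4 * Real.pi * Fintype.card d) *
          (ENNReal.ofReal ((1 + FunctionSpaces.Torus.freqNormSq k) ^ (1 / 2 : ℝ)) *
            (∑' j, U (k - j) * W j) ^ 2) := by
    intro k
    have e1 : ‖((-γ k : ℝ) : ℂ)‖ₑ ^ 2 = ENNReal.ofReal (γ k ^ 2) := by
      rw [← ofReal_norm, Complex.norm_real, Real.norm_eq_abs, abs_neg,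
        ← ENNReal.ofReal_pow (abs_nonneg _), sq_abs]
    have e2 : ‖(-(2 * Real.pi * Complex.I) : ℂ)‖ₑ ^ 2 = ENNReal.ofReal ((2 * Real.pi) ^ 2) := by
      rw [← ofReal_norm, norm_neg, ← ENNReal.ofReal_pow (norm_nonneg _)]
      congr 2
      simp [abs_of_pos hπ]
    have hprod := enorm_sq_mFourierCoeff_inner_smul_le hu hw (FunctionSpaces.Torus.latticeVec k) k
    rw [enorm_smul, enorm_smul, mul_pow, mul_pow, e1, e2]
    calc ENNReal.ofReal (γ k ^ 2) * (ENNReal.ofReal ((2 * Real.pi) ^ 2) *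
          ‖mFourierCoeff (FunctionSpaces.EuclideanSpace.complexify ∘
            fun x => ⟪FunctionSpaces.Torus.latticeVec k, u x⟫_ℝ • w x) k‖ₑ ^ 2)
        ≤ ENNReal.ofReal (γ k ^ 2) * (ENNReal.ofReal ((2 * Real.pi) ^ 2) *
            ((Fintype.card d : ℝ≥0∞) * (ENNReal.ofReal ‖FunctionSpaces.Torus.latticeVec k‖ *
              ∑' j, U (k - j) * W j) ^ 2)) := by gcongr
      _ = (ENNReal.ofReal (γ k ^ 2) * ENNReal.ofReal ((2 * Real.pi) ^ 2) * (Fintype.card d : ℝ≥0∞) *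
            ENNReal.ofReal ‖FunctionSpaces.Torus.latticeVec k‖ ^ 2) * (∑' j, U (k - j) * W j) ^ 2 := by
          ring
      _ = ENNReal.ofReal ((2 * Real.pi) ^ 2 * γ k ^ 2 * (Fintype.card d) *
            FunctionSpaces.Torus.freqNormSq k) * (∑' j, U (k - j) * W j) ^ 2 := by
          congr 1
          rw [← ENNReal.ofReal_pow (norm_nonneg _), norm_latticeVec_sq_aux, ← ENNReal.ofReal_natCast,
            ← ENNReal.ofReal_mul (sq_nonneg _), ← ENNReal.ofReal_mul (by positivity),
            ← ENNReal.ofReal_mul (by positivity)]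
          congr 1
          ring
      _ ≤ ENNReal.ofReal (4 * Real.pi * Fintype.card d * (1 + FunctionSpaces.Torus.freqNormSq k) ^ (1 / 2 : ℝ)) *
            (∑' j, U (k - j) * W j) ^ 2 :=
          mul_le_mul_left (ENNReal.ofReal_le_ofReal (stokesWeight_bound k)) _
      _ = ENNReal.ofReal (4 * Real.pi * Fintype.card d) *
          (ENNReal.ofReal ((1 + FunctionSpaces.Torus.freqNormSq k) ^ (1 / 2 : ℝ)) *
            (∑' j, U (k - j) * W j) ^ 2) := by
          rw [ENNReal.ofReal_mul (by positivity), mul_assoc]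
  calc ∑' k : d → ℤ, ‖((-γ k : ℝ) : ℂ) • ((-(2 * Real.pi * Complex.I)) •
          mFourierCoeff (FunctionSpaces.EuclideanSpace.complexify ∘
            fun x => ⟪FunctionSpaces.Torus.latticeVec k, u x⟫_ℝ • w x) k)‖ₑ ^ 2
      ≤ ∑' k : d → ℤ, ENNReal.ofReal (4 * Real.pi * Fintype.card d) *
          (ENNReal.ofReal ((1 + FunctionSpaces.Torus.freqNormSq k) ^ (1 / 2 : ℝ)) *
            (∑' j, U (k - j) * W j) ^ 2) := ENNReal.tsum_le_tsum hterm
    _ = ENNReal.ofReal (4 * Real.pi * Fintype.card d) *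
          ∑' k : d → ℤ, ENNReal.ofReal ((1 + FunctionSpaces.Torus.freqNormSq k) ^ (1 / 2 : ℝ)) *
            (∑' j, U (k - j) * W j) ^ 2 := ENNReal.tsum_mul_left
    _ ≤ ENNReal.ofReal (4 * Real.pi * Fintype.card d) * (ENNReal.ofReal K *
          ((∑' j, ENNReal.ofReal (1 + FunctionSpaces.Torus.freqNormSq j) * U j ^ 2) *
            (∑' j, ENNReal.ofReal (1 + FunctionSpaces.Torus.freqNormSq j) * W j ^ 2))) :=
        mul_le_mul_right (hPL U W) _
    _ = ENNReal.ofReal (4 * Real.pi * Fintype.card d * K) *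
          ((∑' j, ENNReal.ofReal (1 + FunctionSpaces.Torus.freqNormSq j) * U j ^ 2) *
            (∑' j, ENNReal.ofReal (1 + FunctionSpaces.Torus.freqNormSq j) * W j ^ 2)) := by
        rw [← mul_assoc, ← ENNReal.ofReal_mul (by positivity)]

/-! ### `L²` bookkeeping: sums, uniqueness, square-summability -/

omit [DecidableEq d] in
/-- Fourier coefficients of a sum of `L²` classes. [folklore] -/
theorem mFourierCoeff_complexify_coe_add
    (v w : Lp (EuclideanSpace ℝ d) 2 (volume : Measure (UnitAddTorus d))) (k : d → ℤ) :
    mFourierCoeff (FunctionSpaces.EuclideanSpace.complexify ∘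
        ((v + w : Lp (EuclideanSpace ℝ d) 2 (volume : Measure (UnitAddTorus d))) :
          UnitAddTorus d → EuclideanSpace ℝ d)) k =
      mFourierCoeff (FunctionSpaces.EuclideanSpace.complexify ∘ (v : UnitAddTorus d → EuclideanSpace ℝ d)) k +
        mFourierCoeff (FunctionSpaces.EuclideanSpace.complexify ∘ (w : UnitAddTorus d → EuclideanSpace ℝ d)) k := by
  have h := mFourierCoeff_complexify_coe_sub (v + w) w k
  rw [add_sub_cancel_right] at h
  rw [h, sub_add_cancel]

omit [DecidableEq d] in
/-- **Uniqueness of Fourier coefficients for `L²` classes**: two classes with the same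
coefficients are equal (`Torus.ae_eq_of_forall_mFourierCoeff_eq`; Grafakos 2014, Prop. 3.2.7).
[folklore] -/
theorem Lp_eq_of_forall_mFourierCoeff_eq
    {v w : Lp (EuclideanSpace ℝ d) 2 (volume : Measure (UnitAddTorus d))}
    (h : ∀ k : d → ℤ,
      mFourierCoeff (FunctionSpaces.EuclideanSpace.complexify ∘ (v : UnitAddTorus d → EuclideanSpace ℝ d)) k =
        mFourierCoeff (FunctionSpaces.EuclideanSpace.complexify ∘ (w : UnitAddTorus d → EuclideanSpace ℝ d)) k) :
    v = w := by
  have hvi : Integrable (FunctionSpaces.EuclideanSpace.complexify ∘ (v : UnitAddTorus d → EuclideanSpace ℝ d)) volume :=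
    FunctionSpaces.Torus.integrable_complexify_comp ((Lp.memLp v).integrable one_le_two)
  have hwi : Integrable (FunctionSpaces.EuclideanSpace.complexify ∘ (w : UnitAddTorus d → EuclideanSpace ℝ d)) volume :=
    FunctionSpaces.Torus.integrable_complexify_comp ((Lp.memLp w).integrable one_le_two)
  have hae := FunctionSpaces.Torus.ae_eq_of_forall_mFourierCoeff_eq hvi hwi h
  exact Lp.ext (hae.mono fun x hx => FunctionSpaces.EuclideanSpace.complexify_injective hx)

omit [Fintype d] [DecidableEq d] in
/-- A family with `∑ ‖cₖ‖ₑ² < ∞` has summable squared norms. [folklore] -/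
theorem summable_sq_norm_of_tsum_enorm_sq_ne_top {α E : Type*} [NormedAddCommGroup E] {c : α → E}
    (h : ∑' k, ‖c k‖ₑ ^ 2 ≠ ∞) : Summable fun k => ‖c k‖ ^ 2 := by
  have e : ∀ k, ‖c k‖ₑ ^ 2 = (((‖c k‖₊ ^ 2 : NNReal)) : ℝ≥0∞) := fun k => by
    rw [ENNReal.coe_pow, enorm_eq_nnnorm]
  simp only [e] at h
  have hs := ENNReal.tsum_coe_ne_top_iff_summable.1 h
  have hs' := NNReal.summable_coe.2 hs
  convert hs' using 1
  funext k
  simp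

/-! ### Eigenvalues are determined by the mode -/

/-- If a basis vector of norm one is the Stokes mode `stokesModeL2 k a c` and also has the symbol
`m i = 4π²|k₀|²` of another representation, then `m i = 4π²|k|²`: both `(b i, m i • b i)` and
`(b i, 4π²|k|² • b i)` lie in the (functional) Stokes graph. [folklore] -/
theorem eq_stokesEigenvalue_of_coe_eq_stokesModeL2 {ι : Type*}
    (b : HilbertBasis ι ℝ (FunctionSpaces.Torus.energySpace d)) (m : ι → ℝ)
    (hb : ∀ i, ∃ (k : d → ℤ) (a : EuclideanSpace ℝ d) (c : Bool),
      ((b i : FunctionSpaces.Torus.energySpace d) :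
          Lp (EuclideanSpace ℝ d) 2 (volume : Measure (UnitAddTorus d))) = stokesModeL2 k a c ∧
        m i = stokesEigenvalue k)
    (i : ι) {k : d → ℤ} {a : EuclideanSpace ℝ d} {c : Bool}
    (h : ((b i : FunctionSpaces.Torus.energySpace d) :
      Lp (EuclideanSpace ℝ d) 2 (volume : Measure (UnitAddTorus d))) = stokesModeL2 k a c) :
    m i = stokesEigenvalue k := by
  obtain ⟨k₀, a₀, c₀, h₀, hm₀⟩ := hb i
  set v : Lp (EuclideanSpace ℝ d) 2 (volume : Measure (UnitAddTorus d)) :=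
    ((b i : FunctionSpaces.Torus.energySpace d) : Lp (EuclideanSpace ℝ d) 2 (volume : Measure (UnitAddTorus d)))
    with hv
  have hA : IsStokesImage v (m i • v) := by
    have := isStokesImage_stokesModeL2 (d := d) k₀ a₀ c₀
    rwa [← h₀, ← hm₀] at this
  have hB : IsStokesImage v (stokesEigenvalue k • v) := by
    have := isStokesImage_stokesModeL2 (d := d) k a c
    rwa [← h] at this
  have hdiff : IsStokesImage (0 : Lp (EuclideanSpace ℝ d) 2 (volume : Measure (UnitAddTorus d)))
      ((m i - stokesEigenvalue k) • v) := by
    have h2 := hA.add (hB.smul (-1))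
    have e1 : v + (-1 : ℝ) • v = 0 := by rw [neg_one_smul, add_neg_cancel]
    have e2 : m i • v + (-1 : ℝ) • (stokesEigenvalue k • v) = (m i - stokesEigenvalue k) • v := by
      rw [smul_smul, ← add_smul]; ring_nf
    rwa [e1, e2] at h2
  have hmem : ((0 : Lp (EuclideanSpace ℝ d) 2 (volume : Measure (UnitAddTorus d))),
      (m i - stokesEigenvalue k) • v) ∈ stokesGraph d :=
    ⟨zero_mem _, Submodule.smul_mem _ _ (b i).2, hdiff⟩
  have hzero := stokesGraph_fst_eq_zero_imp _ hmem rfl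
  dsimp only at hzero
  rcases smul_eq_zero.1 hzero with h1 | h1
  · linarith
  · exfalso
    rw [hv] at h1
    exact b.orthonormal.ne_zero i (Submodule.coe_eq_zero.1 h1)

end Torus

end Literature.Analysis.FluidPDE

end
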